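import Mathlib
import Literature.MathematicalPhysics.StatisticalMechanics.Crystallization
import Literature.MathematicalPhysics.StatisticalMechanics.LennardJonesClusters
import Summits.AtomisticToContinuum.Crystallization.Theorems.ThreeConeCertificateExactCertificateTransfer1DCore
import Summits.AtomisticToContinuum.Crystallization.Theorems.ThreeConeCertificateExactCertificateTransfer1DChain
import Summits.AtomisticToContinuum.Crystallization.Theorems.ThreeConeCertificateExactCertificateTransfer1DCrossing
import Summits.AtomisticToContinuum.Crystallization.Theorems.ThreeConeCertificateExactCertificateTransfer1DPsiPosType
import Summits.AtomisticToContinuum.Crystallization.Theorems.ThreeConeCertificateExactCertificateTransfer1DPosType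
import Summits.AtomisticToContinuum.Crystallization.Theorems.ThreeConeCertificateExactCertificateTransfer1DMatern
import Summits.AtomisticToContinuum.Crystallization.Theorems.ThreeConeCertificateExactCertificateTransfer1DTail

/-!
# Crux `ExactCertificate` (stmt-AtomisticToContinuum-11959), line `closure-makes-nogap-exact`:
# the TRANSFER THEOREM — an exact three-cone certificate for the Lennard-Jones CHAIN (d = 1)

Support file (`--supports stmt-AtomisticToContinuum-11959`); nothing here closes the 3-D crux, which is
`NoGap ∧ KeplerBound` with `KeplerBound` = item 11961 ↔ 0627 (open).  This file proves the d = 1 analogue of the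
crux VERBATIM (`3 ↦ 1`), i.e. the statement `ExactCertificate1D` typed by the crux strategist
(`Cruxes/ExactCertificate/Transfer1D.lean`, STRATEGY-CENSUS §2a), whose two analytic inputs the census could only
certify numerically.  Here they get a structural proof.

## Statement (`exactCertificate1D`)

There are a periodic configuration `P` of `ℝ¹` (the chain `aℤ` at the ZERO-PRESSURE lattice constant `a`,
`a⁶ = ζ(12)/ζ(6)`, `a ≈ 0.99718`), a range `ρ` (`= a`, the minimal distance of `P`), a constant `c` (`= 0`) and a
split `V_LJ = g + U + f` on `(0,∞)` with `g ≡ 0` on `[ρ,∞)` and `g` `c`-stable (indeed `g ≥ 0`), `U ≥ 0` (indeed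
`U ≡ 0`), `f` of positive type on `ℝ¹`, and `c + f(0)/2 = −e_{V_LJ}(P)`.  Consequence (`keplerBound1D`): the SHARP
Kepler-type bound `N·e(aℤ) ≤ E_N(x)` for every `N` and every configuration of `N` distinct points on a line — the
optimal stability constant of the one-dimensional Lennard-Jones gas is the energy per particle of the zero-pressure
chain (the value identified by Ventevogel 1978 / Ventevogel–Nijboer 1979 and, for finite `N`, Gardner–Radin 1979;
the certificate itself — a sharp Fisher–Ruelle two-cone split with a Cohn–Kumar-type pair function `f ≤ V_LJ`
tangent to `V_LJ` on the far shells and invisible to `aℤ` — appears to be new).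

## Construction and mechanism

`f = F_a`, `F_a(x) = Σ_{k≥0}(k+1)[V(|x+a|+(k+1)a) − 2V(|x|+(k+1)a) + V(|x−a|+(k+1)a)] = −¼Δ_aΨ_a(x)` with the
retarded Green's function `Ψ_a(x) = −4Σ_{k≥0}(k+1)V(|x|+(k+1)a)`; `g = (V − F_a)·1_{(0,a)}`.  Telescoping gives
`F_a = V` on `[a,∞)` and `F_a(0) = −2Σ_{m≥1}V(ma) = −2e(aℤ)` (`stub_tailFzero`, `stub_chain`).  The two inequalities
— `F_a` of positive type and `F_a ≤ V` on `(0,a)` — both follow from ONE fact: `−V_LJ` is the Laplace transform of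
`p(t) = t⁵/6! − t¹¹/12!`, a density with a SINGLE sign change, and zero pressure says exactly that the `t`-moment
`Σ_k(k+1)∫₀^∞e^{−t(k+1)a}t·p(t)dt` vanishes; hence `Σ_k(k+1)∫₀^∞e^{−t(k+1)a}p(t)·t·h(t)dt ≥ 0` for every ANTITONE `h`
(`stub_crossing`).  Taking `h(t) = Q(t)/t` with `Q` the Gram form of `e^{−t|·|}` (antitone ⇔ the Matérn-3/2 kernel
`(1+t|x|)e^{−t|x|}` is positive definite — a one-sided Gram identity, `stub_quadAntitone`) yields positive type of
`Ψ_a` (`stub_psiPosTypeOf`) and, by the doubling trick, of `F_a` (`stub_posTypeOfPsi`); taking `h(t) = −sinh(tu)/t`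
(antitone by convexity of `sinh`) yields `V − F_a = Σ_{m≥1}m[V(ma−u) − V(ma+u)] ≥ 0` on `(0,a)` (`stub_coreOf`).
No Fourier analysis and no numerics enter.

## The energetic corollary

`HasPeriodicGroundStateEnergy lennardJones 1` (conjunct (i) of the summit sub-problem with `3 ↦ 1`) follows in the
companion file `ThreeConeCertificateExactCertificateTransfer1DEnergetic.lean`.

## Why this is the crux's TRANSFER exhibit (STRATEGY-CENSUS §2a)

The mechanism has a finite-range INVISIBILITY OPERATOR (`−¼Δ_a`, symbol `sin²(πaξ)`, vanishing exactly on the dual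
lattice) and a retarded Green's function on a half-line; in `d = 3` no finite-range RADIAL invisibility operator
exists (`O(K)` zeros of an entire function of exponential type against `≍ K²` Bragg radii), which is where every
3-D line of this crux died (far-field wall W1).
-/

noncomputable section

namespace Summit.AtomisticToContinuum.Crystallization.Theorems.ThreeConeCertificateExactCertificate.Transfer1D

open Literature.MathematicalPhysics.StatisticalMechanics MeasureTheory Set
open scoped BigOperators

/-- **Zero pressure.**  There is `a > 0` (namely `a⁶ = ζ(12)/ζ(6)`, `a ≈ 0.99718`) with
`Σ_{k≥0} (k+1)·[((k+1)a)⁻⁷ − ((k+1)a)⁻¹³] = 0`, i.e. `Σ_{m≥1} m·V_LJ′(ma) = 0`: the chain `aℤ` is in mechanical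
equilibrium (equivalently `a` minimises `a ↦ e_{V_LJ}(aℤ) = ζ(12)a⁻¹²/12 − ζ(6)a⁻⁶/6`). [folklore] -/
theorem zeroPressure_exists : ∃ a : ℝ, 0 < a ∧
    HasSum (fun k : ℕ => ((k : ℝ) + 1) * ((((k : ℝ) + 1) * a)⁻¹ ^ 7 - (((k : ℝ) + 1) * a)⁻¹ ^ 13)) 0 := by
  -- the two zeta values as sums over `k + 1`
  have hs6 : Summable (fun k : ℕ => ((k : ℝ) + 1)⁻¹ ^ 6) := by
    have h := (Real.summable_nat_pow_inv.2 (by norm_num : 1 < 6))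
    have h' := (summable_nat_add_iff 1).2 h
    refine h'.congr fun k => ?_
    push_cast
    rw [inv_pow]
  have hs12 : Summable (fun k : ℕ => ((k : ℝ) + 1)⁻¹ ^ 12) := by
    have h := (Real.summable_nat_pow_inv.2 (by norm_num : 1 < 12))
    have h' := (summable_nat_add_iff 1).2 h
    refine h'.congr fun k => ?_
    push_cast
    rw [inv_pow]
  set Z6 : ℝ := ∑' k : ℕ, ((k : ℝ) + 1)⁻¹ ^ 6 with hZ6
  set Z12 : ℝ := ∑' k : ℕ, ((k : ℝ) + 1)⁻¹ ^ 12 with hZ12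
  have hZ6pos : 0 < Z6 := by
    refine lt_of_lt_of_le (by positivity : (0:ℝ) < ((((0:ℕ) : ℝ) + 1)⁻¹ ^ 6)) ?_
    exact le_hasSum hs6.hasSum 0 fun k _ => by positivity
  have hZ12pos : 0 < Z12 := by
    refine lt_of_lt_of_le (by positivity : (0:ℝ) < ((((0:ℕ) : ℝ) + 1)⁻¹ ^ 12)) ?_
    exact le_hasSum hs12.hasSum 0 fun k _ => by positivity
  -- the lattice constant
  set a : ℝ := (Z12 / Z6) ^ ((1 : ℝ) / 6) with ha
  have hapos : 0 < a := Real.rpow_pos_of_pos (div_pos hZ12pos hZ6pos) _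
  have ha6 : a ^ 6 = Z12 / Z6 := by
    rw [ha, ← Real.rpow_natCast, ← Real.rpow_mul (div_pos hZ12pos hZ6pos).le]
    norm_num
  refine ⟨a, hapos, ?_⟩
  -- termwise: (k+1)·((k+1)a)⁻⁷ = a⁻⁷ (k+1)⁻⁶ and (k+1)·((k+1)a)⁻¹³ = a⁻¹³ (k+1)⁻¹²
  have hterm : ∀ k : ℕ, ((k : ℝ) + 1) * ((((k : ℝ) + 1) * a)⁻¹ ^ 7 - (((k : ℝ) + 1) * a)⁻¹ ^ 13)
      = a⁻¹ ^ 7 * ((k : ℝ) + 1)⁻¹ ^ 6 - a⁻¹ ^ 13 * ((k : ℝ) + 1)⁻¹ ^ 12 := by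
    intro k
    have hk : (k : ℝ) + 1 ≠ 0 := by positivity
    have hane : a ≠ 0 := hapos.ne'
    rw [mul_inv, mul_pow, mul_pow]
    field_simp
  have hsum : HasSum (fun k : ℕ => a⁻¹ ^ 7 * ((k : ℝ) + 1)⁻¹ ^ 6 - a⁻¹ ^ 13 * ((k : ℝ) + 1)⁻¹ ^ 12)
      (a⁻¹ ^ 7 * Z6 - a⁻¹ ^ 13 * Z12) :=
    (hs6.hasSum.mul_left _).sub (hs12.hasSum.mul_left _)
  have hval : a⁻¹ ^ 7 * Z6 - a⁻¹ ^ 13 * Z12 = 0 := by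
    have hZ6ne : Z6 ≠ 0 := hZ6pos.ne'
    have hane : a ≠ 0 := hapos.ne'
    have h12 : Z12 = a ^ 6 * Z6 := by rw [ha6]; field_simp
    rw [h12]
    field_simp
    ring
  rw [hval] at hsum
  simpa only [hterm] using hsum

/-- **THE d = 1 EXACT CERTIFICATE** (`ExactCertificate1D` of `Cruxes/ExactCertificate/Transfer1D.lean`: the crux
`ThreeConeCertificate.ExactCertificate` with `3 ↦ 1`, verbatim otherwise).  Witness: `P = aℤ` at zero pressure,
`ρ = a`, `c = 0`, `g = (V − F_a)1_{(0,a)}`, `U = 0`, `f = F_a` (module docstring).  Composition of the seven landed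
stubs of the Transfer skeleton. [folklore] -/
theorem exactCertificate1D :
    ∃ (P : PeriodicConfiguration 1) (ρ c : ℝ) (g U f : ℝ → ℝ),
      (∀ r : ℝ, 0 < r → lennardJones r = g r + U r + f r) ∧ (∀ r : ℝ, 0 < r → 0 ≤ U r) ∧
      (∀ r : ℝ, ρ ≤ r → g r = 0) ∧
      (∀ (n : ℕ) (y : Fin n → EuclideanSpace ℝ (Fin 1)) (w : Fin n → ℝ),
        0 ≤ ∑ i, ∑ j, w i * w j * f (dist (y i) (y j))) ∧
      (∀ (N : ℕ) (x : Fin N → EuclideanSpace ℝ (Fin 1)), Function.Injective x →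
        -(c * (N : ℝ)) ≤ interactionEnergy g x) ∧
      c + f 0 / 2 = -(P.energyPerParticle lennardJones) := by
  obtain ⟨a, ha, hz⟩ := zeroPressure_exists
  obtain ⟨P, hP⟩ := stub_chain a ha
  obtain ⟨htail, hF0⟩ := stub_tailFzero a ha
  -- the tail interpolant `F_a`
  set Fa : ℝ → ℝ := fun x => ∑' k : ℕ, ((k : ℝ) + 1) * (lennardJones (|x + a| + ((k : ℝ) + 1) * a)
      - 2 * lennardJones (|x| + ((k : ℝ) + 1) * a) + lennardJones (|x - a| + ((k : ℝ) + 1) * a)) with hFa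
  have hFa_tail : ∀ x : ℝ, a ≤ x → Fa x = lennardJones x := fun x hx => htail x hx
  have hFa_zero : Fa 0 = -2 * ∑' k : ℕ, lennardJones (((k : ℝ) + 1) * a) := by
    rw [← hF0, hFa]
    simp only [zero_add, zero_sub, abs_neg, abs_zero, abs_of_pos ha]
  have hcore : ∀ r : ℝ, 0 < r → r < a → Fa r ≤ lennardJones r :=
    fun r hr hra => stub_coreOf stub_crossing a ha hz r hr hra
  have hpos : ∀ (n : ℕ) (y : Fin n → EuclideanSpace ℝ (Fin 1)) (w : Fin n → ℝ),
      0 ≤ ∑ i, ∑ j, w i * w j * Fa (dist (y i) (y j)) :=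
    stub_posTypeOfPsi a ha (stub_psiPosTypeOf stub_quadAntitone stub_crossing a ha hz)
  refine ⟨P, a, 0, fun r => if r < a then lennardJones r - Fa r else 0, fun _ => 0, Fa,
    ?_, fun _ _ => le_rfl, ?_, hpos, ?_, ?_⟩
  · -- (S1) the split on (0,∞)
    intro r _
    show lennardJones r = (if r < a then lennardJones r - Fa r else 0) + 0 + Fa r
    by_cases h : r < a
    · rw [if_pos h]; ring
    · rw [if_neg h, hFa_tail r (not_lt.1 h)]; ring
  · -- (S3) finite range `ρ = a`
    intro r hr
    show (if r < a then lennardJones r - Fa r else 0) = 0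
    rw [if_neg (not_lt.2 hr)]
  · -- (S5) `0`-stability: `g ≥ 0` pair by pair
    intro N x hx
    rw [zero_mul, neg_zero]
    unfold interactionEnergy
    refine Finset.sum_nonneg fun i _ => Finset.sum_nonneg fun j hj => ?_
    have hd : 0 < dist (x i) (x j) := dist_pos.2 fun heq => (Finset.mem_Ioi.1 hj).ne' (hx heq.symm)
    show 0 ≤ (if dist (x i) (x j) < a then lennardJones (dist (x i) (x j)) - Fa (dist (x i) (x j)) else 0)
    by_cases h : dist (x i) (x j) < a
    · rw [if_pos h]
      exact sub_nonneg.2 (hcore _ hd h)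
    · rw [if_neg h]
  · -- (S6) the value: `0 + F_a(0)/2 = −e(aℤ)`
    rw [hP, hFa_zero]
    ring

/-- **The one-dimensional Kepler bound with the sharp constant.**  Some periodic configuration `P` of the line (the
zero-pressure chain `aℤ`) satisfies `N·e_{V_LJ}(P) ≤ E_N(x)` for every `N` and every configuration `x` of `N`
distinct points: `E_V = E_g + E_U + E_f ≥ 0 + 0 − N·f(0)/2` (Bochner with unit weights).  The d = 1 analogue of
route item `KeplerBound` (11961), obtained from the certificate in ten lines exactly as `CertificateBound` does in
d = 3; the value agrees with the infinite-volume ground state of Ventevogel 1978 / Gardner–Radin 1979. [folklore] -/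
theorem keplerBound1D : ∃ P : PeriodicConfiguration 1, ∀ (N : ℕ) (x : Fin N → EuclideanSpace ℝ (Fin 1)),
    Function.Injective x → (N : ℝ) * P.energyPerParticle lennardJones ≤ interactionEnergy lennardJones x := by
  obtain ⟨P, ρ, c, g, U, f, hsplit, hU, -, hpos, hstab, hval⟩ := exactCertificate1D
  refine ⟨P, fun N x hx => ?_⟩
  have hE : interactionEnergy lennardJones x =
      interactionEnergy g x + interactionEnergy U x + interactionEnergy f x := by
    unfold interactionEnergy
    rw [← Finset.sum_add_distrib, ← Finset.sum_add_distrib]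
    refine Finset.sum_congr rfl fun i _ => ?_
    rw [← Finset.sum_add_distrib, ← Finset.sum_add_distrib]
    refine Finset.sum_congr rfl fun j hj => ?_
    have hd : 0 < dist (x i) (x j) := dist_pos.2 fun heq => (Finset.mem_Ioi.1 hj).ne' (hx heq.symm)
    exact hsplit _ hd
  have hUE : 0 ≤ interactionEnergy U x := by
    unfold interactionEnergy
    refine Finset.sum_nonneg fun i _ => Finset.sum_nonneg fun j hj => hU _ ?_
    exact dist_pos.2 fun heq => (Finset.mem_Ioi.1 hj).ne' (hx heq.symm)
  have hgE := hstab N x hx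
  have hfE : -((N : ℝ) * f 0 / 2) ≤ interactionEnergy f x := by
    have h1 := hpos N x (fun _ => 1)
    simp only [one_mul] at h1
    have h2 : ∑ i, ∑ j, f (dist (x i) (x j)) = N * f 0 + 2 * interactionEnergy f x := by
      rw [two_mul_interactionEnergy]
      have h : ∀ i : Fin N, ∑ j, f (dist (x i) (x j)) = f 0 + siteEnergy f x i := fun i => by
        rw [siteEnergy, ← Finset.add_sum_erase Finset.univ _ (Finset.mem_univ i), dist_self]
      simp only [h, Finset.sum_add_distrib, Finset.sum_const, Finset.card_univ, Fintype.card_fin,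
        nsmul_eq_mul]
    rw [h2] at h1
    linarith
  have hv : P.energyPerParticle lennardJones = -(c + f 0 / 2) := by rw [hval]; ring
  rw [hv, hE]
  nlinarith [hgE, hUE, hfE]

/-- Hence `e(P) ≤ E(N)/N` for the one-dimensional Lennard-Jones ground-state energy `E(N)` and every `N ≥ 1`
(the infimum over the non-empty set of injective configurations). [folklore] -/
theorem energyPerParticle_le_groundStateEnergy_div : ∃ P : PeriodicConfiguration 1, ∀ N : ℕ, 0 < N →
    P.energyPerParticle lennardJones ≤ groundStateEnergy lennardJones 1 N / N := by
  obtain ⟨P, hP⟩ := keplerBound1D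
  refine ⟨P, fun N hN => ?_⟩
  have hNr : (0 : ℝ) < N := by exact_mod_cast hN
  rw [le_div_iff₀ hNr, mul_comm]
  unfold groundStateEnergy
  haveI : Nonempty {x : Fin N → EuclideanSpace ℝ (Fin 1) // Function.Injective x} :=
    let ⟨x, hx⟩ := nonempty_injective_config (d := 1) one_pos N; ⟨⟨x, hx⟩⟩
  exact le_ciInf fun x => hP N x.1 x.2

end Summit.AtomisticToContinuum.Crystallization.Theorems.ThreeConeCertificateExactCertificate.Transfer1D

end
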